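import Summits.HodgeConjecture.HodgeConjecture.Theorems.HeckePrymWeilHeckePrymAnchorsOfDeligneWeilFamily
import Summits.HodgeConjecture.HodgeConjecture.Theorems.HeckePrymWeilWeilTwelvefoldsSqrtMinus7OfGlobalAction
import Literature.AlgebraicGeometry.HodgeTheory.WeilFamilyKAction
import HarnessLib

/-!
# `WeilTwelvefoldsSqrtMinus7` — and the whole `ℚ(√-p)` Hodge–Weil sector — from the two ROUTE ITEMS `DeligneWeilFamily` and `WeilVariationalHodge`

Route `HeckePrymWeil` (sub-problem `HodgeConjecture`); lead seat c8 of crux `WeilTwelvefoldsSqrtMinus7`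
(stmt-HodgeConjecture-1261), line `isotypic-unimodular-saturation`, reshape r6.

On 2026-08-16 (21:17Z) the route-choice planner PROMOTED the Literature apex of every registered line of the
rung cruxes — Deligne's abelian scheme with `𝒪_K`-action through the target `X`
([Deligne1982HodgeCycles], proof of Thm. 4.8, pp. 47–51), packaged in the tree as the named fact
`HodgeTheory.deligne1982_weilFamily_kAction` (M‴) — to the ROUTE ITEM stmt-HodgeConjecture-16866
`HeckePrymWeil.DeligneWeilFamily`, in its GLOBAL-CLASS rendering (the fact's continuous section `σ` of
`FiberClass f (2k)` through `e^{-1*}c` replaced by ONE global class `W ∈ H^{2k}(𝒳(ℂ); ℂ)` with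
`W|_{𝒳_{s₁}} = e^{-1*}c`, `IsQuasiProjectiveOver S` inlined, every other clause verbatim).  The route file
(rev 18) does not render the decl yet, so its statement is spelled out verbatim below (fully qualified, as
filed); once rendered, each theorem applies to the decl by `δ`-unfolding.

This file records, sorry-free and definition-free (lead c8 of crux 1261, consuming the sibling glue):

* (context) the promotion is FAITHFUL — item 16866 ⟺ `deligne1982_weilFamily_kAction` (⟺ `…_globalAction`) —
  by the two landed glue theorems of the lead of the sibling crux `HeckePrymAnchors`:
  `kAction_of_deligneWeilFamily` (σ := `globalSection W`) and `deligneWeilFamily_of_kAction` (W-engine: Leray /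
  theorem of the fixed part, discharged in the tree); this file only CONSUMES the first.
* `hodgeWeil_of_weilVariationalHodge_of_deligneWeilFamily` — `HWA(p, k)` for EVERY `p ≡ 3 (4)` prime `≥ 7`
  and EVERY `k ≥ 1` (the whole `ℚ(√-p)` Hodge–Weil sector) from the two route items
  `DeligneWeilFamily` (16866) and `WeilVariationalHodge` (14497): the planner's `FamilySectorGlue`.
* the crux `weilTwelvefoldsSqrtMinus7_of_weilVariationalHodge_of_deligneWeilFamily` (rung `(7,3)` =
  `HWA(7,6)`), the target `hodgeWeilLadder_of_weilVariationalHodge_of_deligneWeilFamily`, and the summit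
  given the off-sector conjunct `hodgeConjecture_of_deligneWeilFamily_of_weilVariationalHodge_of_offWeilSector`
  — the `closes`-shaped standing of the route with the rung cruxes, `HeckePrymAnchors`, `ProductDescent`
  and `WeilDescending` all eliminated.

CONDITIONAL on the hypotheses spelled out (two open route items); no `sorry`, no new definition.
-/

noncomputable section

-- every declaration of this problem lives in `Summit.HodgeConjecture.HodgeConjecture.…` (summit = sub-problem)
set_option linter.dupNamespace false

open CategoryTheory AlgebraicGeometry Limits MonoidalCategory CartesianMonoidalCategory

namespace Summit.HodgeConjecture.HodgeConjecture.Theorems.HeckePrymWeilLine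

open Literature.AlgebraicGeometry Literature.AlgebraicGeometry.Motives Literature.AlgebraicGeometry.HodgeTheory
open Summit.HodgeConjecture.HodgeConjecture.Theses.HeckePrymWeil

/-! ### The `ℚ(√-p)` Hodge–Weil sector from the two route items -/

/-- **`HWA(p, k)` for every `p ≡ 3 (4)` prime `≥ 7` and every `k ≥ 1`, from the route items
`DeligneWeilFamily` (stmt-HodgeConjecture-16866) and `WeilVariationalHodge` (stmt-HodgeConjecture-14497)**
(CONDITIONAL; the planner's `FamilySectorGlue`).  Item ⇒ `deligne1982_weilFamily_kAction`
(`kAction_of_deligneWeilFamily`) ⇒ the flat fibrewise-Hodge Weil section with tensor-split fibre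
(`deligne1982_weilFamily_hodgeWeilSection_of_kAction`, tree: balanced fibres by Prop. 4.4 and the transported
Hodge–Riemann form) ⇒ `HWA(p, k)` by the landed `hodgeWeil_of_weilVariationalHodge_of_hodgeWeilSection`
(upgrade of the typing, W-engine, rationality along the section, Lemma 4.5 anchor at the tensor fibre,
transport `WeilVariationalHodge` at `M = k`, return along `e`).
[cite: Deligne1982HodgeCycles, proof of Thm. 4.8 (pp. 47–52) with Prop. 4.4, Lemma 4.5, Remark 4.10]
[cite: Grothendieck1966, footnote 13] -/
theorem hodgeWeil_of_weilVariationalHodge_of_deligneWeilFamily (hF :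
      ∀ p : ℕ, p.Prime → p % 4 = 3 → 7 ≤ p → ∀ (k : ℕ), 1 ≤ k → ∀ (X :
      Literature.AlgebraicGeometry.Motives.AbelianVariety ℂ) (Φ : X ⟶ X), X.dim = 2 * k →
      CategoryTheory.CategoryStruct.comp Φ Φ = -((p : ℤ) • CategoryTheory.CategoryStruct.id X) → ∀ c
      : Literature.AlgebraicGeometry.HodgeTheory.complexBetti X.X (2 * k), c ∈
      Literature.AlgebraicGeometry.HodgeTheory.weilClassesOf X Φ k p → c ≠ 0 →
      Literature.AlgebraicGeometry.HodgeTheory.IsRationalClass c →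
      Literature.AlgebraicGeometry.HodgeTheory.IsOfHodgeType (2 * k) X.X (2 * k) k k c → ∃ (𝒳 S :
      Literature.AlgebraicGeometry.Motives.SchemeOver ℂ) (f : 𝒳 ⟶ S) (g : 𝒳 ⟶ 𝒳) (s₁ s₀ :
      Literature.AlgebraicGeometry.Motives.ComplexPoints S) (e : X.X ≅
      Literature.AlgebraicGeometry.Motives.fiberOver f s₁) (W :
      Literature.AlgebraicGeometry.HodgeTheory.complexBetti 𝒳 (2 * k)),
      Literature.AlgebraicGeometry.Motives.IsSmoothProjectiveFamily f (2 * k) ∧ (∃ (N : ℕ) (ι : 𝒳 ⟶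
      CategoryTheory.MonoidalCategoryStruct.tensorObj
      (Literature.AlgebraicGeometry.Motives.projectiveSpace N ℂ) S),
      AlgebraicGeometry.IsClosedImmersion ι.left ∧ CategoryTheory.CategoryStruct.comp ι
      (CategoryTheory.SemiCartesianMonoidalCategory.snd
      (Literature.AlgebraicGeometry.Motives.projectiveSpace N ℂ) S) = f) ∧ IrreducibleSpace S.left ∧
      AlgebraicGeometry.Smooth S.hom ∧ (∃ (P : Literature.AlgebraicGeometry.Motives.SchemeOver ℂ) (j
      : S ⟶ P), Literature.AlgebraicGeometry.Motives.IsProjectiveOver P ∧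
      AlgebraicGeometry.IsOpenImmersion j.left) ∧ CategoryTheory.CategoryStruct.comp g f = f ∧ (∀ s
      : Literature.AlgebraicGeometry.Motives.ComplexPoints S, ∃ (A' :
      Literature.AlgebraicGeometry.Motives.AbelianVariety ℂ) (φ' : A' ⟶ A') (e' : A'.X ≅
      Literature.AlgebraicGeometry.Motives.fiberOver f s), A'.dim = 2 * k ∧
      CategoryTheory.CategoryStruct.comp φ' φ' = -((p : ℤ) • CategoryTheory.CategoryStruct.id A') ∧
      CategoryTheory.CategoryStruct.comp (CategoryTheory.CategoryStruct.comp e'.hom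
      (Literature.AlgebraicGeometry.Motives.fiberι f s)) g = CategoryTheory.CategoryStruct.comp
      φ'.hom.hom.hom (CategoryTheory.CategoryStruct.comp e'.hom
      (Literature.AlgebraicGeometry.Motives.fiberι f s))) ∧ CategoryTheory.CategoryStruct.comp
      (CategoryTheory.CategoryStruct.comp e.hom (Literature.AlgebraicGeometry.Motives.fiberι f s₁))
      g = CategoryTheory.CategoryStruct.comp Φ.hom.hom.hom (CategoryTheory.CategoryStruct.comp e.hom
      (Literature.AlgebraicGeometry.Motives.fiberι f s₁)) ∧
      Literature.AlgebraicGeometry.HodgeTheory.complexBetti.map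
      (Literature.AlgebraicGeometry.Motives.fiberι f s₁) (2 * k) W =
      Literature.AlgebraicGeometry.HodgeTheory.complexBetti.map e.inv (2 * k) c ∧ ∃ (Y :
      Literature.AlgebraicGeometry.Motives.AbelianVariety ℂ) (Ψ : Y ⟶ Y) (e₀ : Y.X ≅
      Literature.AlgebraicGeometry.Motives.fiberOver f s₀), (∃ (A₁ :
      Literature.AlgebraicGeometry.Motives.AbelianVariety ℂ) (f₁ : Y ⟶ A₁.prod A₁) (g₁ : A₁.prod A₁
      ⟶ Y) (m : ℕ), A₁.dim = k ∧ Y.dim = 2 * k ∧ CategoryTheory.CategoryStruct.comp Ψ Ψ = -((p : ℤ)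
      • CategoryTheory.CategoryStruct.id Y) ∧ 0 < m ∧ CategoryTheory.CategoryStruct.comp f₁ g₁ = m •
      CategoryTheory.CategoryStruct.id Y ∧ AlgebraicGeometry.Flat f₁.hom.hom.hom.left ∧
      CategoryTheory.CategoryStruct.comp g₁ Ψ = CategoryTheory.CategoryStruct.comp
      (Literature.AlgebraicGeometry.Motives.AbelianVariety.prodLift
      (CategoryTheory.CategoryStruct.comp (Literature.AlgebraicGeometry.Motives.AbelianVariety.snd
      A₁ A₁) (-((p : ℤ) • CategoryTheory.CategoryStruct.id A₁)))
      (Literature.AlgebraicGeometry.Motives.AbelianVariety.fst A₁ A₁)) g₁) ∧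
      CategoryTheory.CategoryStruct.comp (CategoryTheory.CategoryStruct.comp e₀.hom
      (Literature.AlgebraicGeometry.Motives.fiberι f s₀)) g = CategoryTheory.CategoryStruct.comp
      Ψ.hom.hom.hom (CategoryTheory.CategoryStruct.comp e₀.hom
      (Literature.AlgebraicGeometry.Motives.fiberι f s₀)))
    (hV : WeilVariationalHodge) :
    ∀ p : ℕ, p.Prime → p % 4 = 3 → 7 ≤ p → ∀ k : ℕ, 1 ≤ k →
    ∀ (A : AbelianVariety ℂ) (φ : A ⟶ A), A.dim = 2 * k → φ ≫ φ = -((p : ℤ) • 𝟙 A) →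
      ∀ c : complexBetti A.X (2 * k), IsRationalClass c → IsOfHodgeType (2 * k) A.X (2 * k) k k c →
        c ∈ Module.End.eigenspace (complexBetti.map (𝟙 A + φ).hom.hom.hom (2 * k)).hom
              ((1 + Complex.I * (Real.sqrt (p : ℝ) : ℂ)) ^ (2 * k)) ⊔
            Module.End.eigenspace (complexBetti.map (𝟙 A + φ).hom.hom.hom (2 * k)).hom
              ((1 - Complex.I * (Real.sqrt (p : ℝ) : ℂ)) ^ (2 * k)) →
        c ∈ algebraicClasses A.X k :=
  hodgeWeil_of_weilVariationalHodge_of_hodgeWeilSection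
    (deligne1982_weilFamily_hodgeWeilSection_of_kAction (kAction_of_deligneWeilFamily hF)) hV

/-! ### The crux, the target, and the summit given the off-sector conjunct -/

/-- **Rung `(7, 3)`: the crux `WeilTwelvefoldsSqrtMinus7` (stmt-HodgeConjecture-1261) from the route items
`DeligneWeilFamily` (stmt-HodgeConjecture-16866) and `WeilVariationalHodge` (stmt-HodgeConjecture-14497)**
(`HWA(7, 6)`; the transport is used at `(p, M) = (7, 6)` only — the family of twelvefolds through `A`
itself).  This is the composition `WeilTwelvefoldsSqrtMinus7_of_stubs` of the registered skeleton r6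
(`Cruxes/WeilTwelvefoldsSqrtMinus7/Lines/isotypic_unimodular_saturation.lean`) with its stub 2 `WT(7,6)`
discharged from `WeilVariationalHodge`. [cite: Deligne1982HodgeCycles, proof of Thm. 4.8]
[cite: Grothendieck1966, footnote 13] -/
theorem weilTwelvefoldsSqrtMinus7_of_weilVariationalHodge_of_deligneWeilFamily (hF :
      ∀ p : ℕ, p.Prime → p % 4 = 3 → 7 ≤ p → ∀ (k : ℕ), 1 ≤ k → ∀ (X :
      Literature.AlgebraicGeometry.Motives.AbelianVariety ℂ) (Φ : X ⟶ X), X.dim = 2 * k →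
      CategoryTheory.CategoryStruct.comp Φ Φ = -((p : ℤ) • CategoryTheory.CategoryStruct.id X) → ∀ c
      : Literature.AlgebraicGeometry.HodgeTheory.complexBetti X.X (2 * k), c ∈
      Literature.AlgebraicGeometry.HodgeTheory.weilClassesOf X Φ k p → c ≠ 0 →
      Literature.AlgebraicGeometry.HodgeTheory.IsRationalClass c →
      Literature.AlgebraicGeometry.HodgeTheory.IsOfHodgeType (2 * k) X.X (2 * k) k k c → ∃ (𝒳 S :
      Literature.AlgebraicGeometry.Motives.SchemeOver ℂ) (f : 𝒳 ⟶ S) (g : 𝒳 ⟶ 𝒳) (s₁ s₀ :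
      Literature.AlgebraicGeometry.Motives.ComplexPoints S) (e : X.X ≅
      Literature.AlgebraicGeometry.Motives.fiberOver f s₁) (W :
      Literature.AlgebraicGeometry.HodgeTheory.complexBetti 𝒳 (2 * k)),
      Literature.AlgebraicGeometry.Motives.IsSmoothProjectiveFamily f (2 * k) ∧ (∃ (N : ℕ) (ι : 𝒳 ⟶
      CategoryTheory.MonoidalCategoryStruct.tensorObj
      (Literature.AlgebraicGeometry.Motives.projectiveSpace N ℂ) S),
      AlgebraicGeometry.IsClosedImmersion ι.left ∧ CategoryTheory.CategoryStruct.comp ι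
      (CategoryTheory.SemiCartesianMonoidalCategory.snd
      (Literature.AlgebraicGeometry.Motives.projectiveSpace N ℂ) S) = f) ∧ IrreducibleSpace S.left ∧
      AlgebraicGeometry.Smooth S.hom ∧ (∃ (P : Literature.AlgebraicGeometry.Motives.SchemeOver ℂ) (j
      : S ⟶ P), Literature.AlgebraicGeometry.Motives.IsProjectiveOver P ∧
      AlgebraicGeometry.IsOpenImmersion j.left) ∧ CategoryTheory.CategoryStruct.comp g f = f ∧ (∀ s
      : Literature.AlgebraicGeometry.Motives.ComplexPoints S, ∃ (A' :
      Literature.AlgebraicGeometry.Motives.AbelianVariety ℂ) (φ' : A' ⟶ A') (e' : A'.X ≅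
      Literature.AlgebraicGeometry.Motives.fiberOver f s), A'.dim = 2 * k ∧
      CategoryTheory.CategoryStruct.comp φ' φ' = -((p : ℤ) • CategoryTheory.CategoryStruct.id A') ∧
      CategoryTheory.CategoryStruct.comp (CategoryTheory.CategoryStruct.comp e'.hom
      (Literature.AlgebraicGeometry.Motives.fiberι f s)) g = CategoryTheory.CategoryStruct.comp
      φ'.hom.hom.hom (CategoryTheory.CategoryStruct.comp e'.hom
      (Literature.AlgebraicGeometry.Motives.fiberι f s))) ∧ CategoryTheory.CategoryStruct.comp
      (CategoryTheory.CategoryStruct.comp e.hom (Literature.AlgebraicGeometry.Motives.fiberι f s₁))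
      g = CategoryTheory.CategoryStruct.comp Φ.hom.hom.hom (CategoryTheory.CategoryStruct.comp e.hom
      (Literature.AlgebraicGeometry.Motives.fiberι f s₁)) ∧
      Literature.AlgebraicGeometry.HodgeTheory.complexBetti.map
      (Literature.AlgebraicGeometry.Motives.fiberι f s₁) (2 * k) W =
      Literature.AlgebraicGeometry.HodgeTheory.complexBetti.map e.inv (2 * k) c ∧ ∃ (Y :
      Literature.AlgebraicGeometry.Motives.AbelianVariety ℂ) (Ψ : Y ⟶ Y) (e₀ : Y.X ≅
      Literature.AlgebraicGeometry.Motives.fiberOver f s₀), (∃ (A₁ :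
      Literature.AlgebraicGeometry.Motives.AbelianVariety ℂ) (f₁ : Y ⟶ A₁.prod A₁) (g₁ : A₁.prod A₁
      ⟶ Y) (m : ℕ), A₁.dim = k ∧ Y.dim = 2 * k ∧ CategoryTheory.CategoryStruct.comp Ψ Ψ = -((p : ℤ)
      • CategoryTheory.CategoryStruct.id Y) ∧ 0 < m ∧ CategoryTheory.CategoryStruct.comp f₁ g₁ = m •
      CategoryTheory.CategoryStruct.id Y ∧ AlgebraicGeometry.Flat f₁.hom.hom.hom.left ∧
      CategoryTheory.CategoryStruct.comp g₁ Ψ = CategoryTheory.CategoryStruct.comp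
      (Literature.AlgebraicGeometry.Motives.AbelianVariety.prodLift
      (CategoryTheory.CategoryStruct.comp (Literature.AlgebraicGeometry.Motives.AbelianVariety.snd
      A₁ A₁) (-((p : ℤ) • CategoryTheory.CategoryStruct.id A₁)))
      (Literature.AlgebraicGeometry.Motives.AbelianVariety.fst A₁ A₁)) g₁) ∧
      CategoryTheory.CategoryStruct.comp (CategoryTheory.CategoryStruct.comp e₀.hom
      (Literature.AlgebraicGeometry.Motives.fiberι f s₀)) g = CategoryTheory.CategoryStruct.comp
      Ψ.hom.hom.hom (CategoryTheory.CategoryStruct.comp e₀.hom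
      (Literature.AlgebraicGeometry.Motives.fiberι f s₀)))
    (hV : WeilVariationalHodge) : WeilTwelvefoldsSqrtMinus7 := by
  intro A φ hA hφ c hrat hH hW
  exact hodgeWeil_of_weilVariationalHodge_of_deligneWeilFamily hF hV 7 (by norm_num) (by norm_num) le_rfl
    6 (by norm_num) A φ hA (by exact_mod_cast hφ) c hrat hH (by exact_mod_cast hW)

/-- **The route TARGET `HodgeWeilLadder` (stmt-HodgeConjecture-1259) from the route items
`DeligneWeilFamily` and `WeilVariationalHodge`** — rung `(p, g)` is `HWA(p, (p-1)/2·(g-1))` and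
`(p-1)/2·(g-1) ≥ 3 ≥ 1`.  Against the route's glue `LadderGlue` this needs neither `HeckePrymAnchors` nor
`ProductDescent` nor `WeilDescending`. [cite: Deligne1982HodgeCycles, proof of Thm. 4.8]
[cite: Grothendieck1966, footnote 13] -/
theorem hodgeWeilLadder_of_weilVariationalHodge_of_deligneWeilFamily (hF :
      ∀ p : ℕ, p.Prime → p % 4 = 3 → 7 ≤ p → ∀ (k : ℕ), 1 ≤ k → ∀ (X :
      Literature.AlgebraicGeometry.Motives.AbelianVariety ℂ) (Φ : X ⟶ X), X.dim = 2 * k →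
      CategoryTheory.CategoryStruct.comp Φ Φ = -((p : ℤ) • CategoryTheory.CategoryStruct.id X) → ∀ c
      : Literature.AlgebraicGeometry.HodgeTheory.complexBetti X.X (2 * k), c ∈
      Literature.AlgebraicGeometry.HodgeTheory.weilClassesOf X Φ k p → c ≠ 0 →
      Literature.AlgebraicGeometry.HodgeTheory.IsRationalClass c →
      Literature.AlgebraicGeometry.HodgeTheory.IsOfHodgeType (2 * k) X.X (2 * k) k k c → ∃ (𝒳 S :
      Literature.AlgebraicGeometry.Motives.SchemeOver ℂ) (f : 𝒳 ⟶ S) (g : 𝒳 ⟶ 𝒳) (s₁ s₀ :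
      Literature.AlgebraicGeometry.Motives.ComplexPoints S) (e : X.X ≅
      Literature.AlgebraicGeometry.Motives.fiberOver f s₁) (W :
      Literature.AlgebraicGeometry.HodgeTheory.complexBetti 𝒳 (2 * k)),
      Literature.AlgebraicGeometry.Motives.IsSmoothProjectiveFamily f (2 * k) ∧ (∃ (N : ℕ) (ι : 𝒳 ⟶
      CategoryTheory.MonoidalCategoryStruct.tensorObj
      (Literature.AlgebraicGeometry.Motives.projectiveSpace N ℂ) S),
      AlgebraicGeometry.IsClosedImmersion ι.left ∧ CategoryTheory.CategoryStruct.comp ι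
      (CategoryTheory.SemiCartesianMonoidalCategory.snd
      (Literature.AlgebraicGeometry.Motives.projectiveSpace N ℂ) S) = f) ∧ IrreducibleSpace S.left ∧
      AlgebraicGeometry.Smooth S.hom ∧ (∃ (P : Literature.AlgebraicGeometry.Motives.SchemeOver ℂ) (j
      : S ⟶ P), Literature.AlgebraicGeometry.Motives.IsProjectiveOver P ∧
      AlgebraicGeometry.IsOpenImmersion j.left) ∧ CategoryTheory.CategoryStruct.comp g f = f ∧ (∀ s
      : Literature.AlgebraicGeometry.Motives.ComplexPoints S, ∃ (A' :
      Literature.AlgebraicGeometry.Motives.AbelianVariety ℂ) (φ' : A' ⟶ A') (e' : A'.X ≅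
      Literature.AlgebraicGeometry.Motives.fiberOver f s), A'.dim = 2 * k ∧
      CategoryTheory.CategoryStruct.comp φ' φ' = -((p : ℤ) • CategoryTheory.CategoryStruct.id A') ∧
      CategoryTheory.CategoryStruct.comp (CategoryTheory.CategoryStruct.comp e'.hom
      (Literature.AlgebraicGeometry.Motives.fiberι f s)) g = CategoryTheory.CategoryStruct.comp
      φ'.hom.hom.hom (CategoryTheory.CategoryStruct.comp e'.hom
      (Literature.AlgebraicGeometry.Motives.fiberι f s))) ∧ CategoryTheory.CategoryStruct.comp
      (CategoryTheory.CategoryStruct.comp e.hom (Literature.AlgebraicGeometry.Motives.fiberι f s₁))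
      g = CategoryTheory.CategoryStruct.comp Φ.hom.hom.hom (CategoryTheory.CategoryStruct.comp e.hom
      (Literature.AlgebraicGeometry.Motives.fiberι f s₁)) ∧
      Literature.AlgebraicGeometry.HodgeTheory.complexBetti.map
      (Literature.AlgebraicGeometry.Motives.fiberι f s₁) (2 * k) W =
      Literature.AlgebraicGeometry.HodgeTheory.complexBetti.map e.inv (2 * k) c ∧ ∃ (Y :
      Literature.AlgebraicGeometry.Motives.AbelianVariety ℂ) (Ψ : Y ⟶ Y) (e₀ : Y.X ≅
      Literature.AlgebraicGeometry.Motives.fiberOver f s₀), (∃ (A₁ :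
      Literature.AlgebraicGeometry.Motives.AbelianVariety ℂ) (f₁ : Y ⟶ A₁.prod A₁) (g₁ : A₁.prod A₁
      ⟶ Y) (m : ℕ), A₁.dim = k ∧ Y.dim = 2 * k ∧ CategoryTheory.CategoryStruct.comp Ψ Ψ = -((p : ℤ)
      • CategoryTheory.CategoryStruct.id Y) ∧ 0 < m ∧ CategoryTheory.CategoryStruct.comp f₁ g₁ = m •
      CategoryTheory.CategoryStruct.id Y ∧ AlgebraicGeometry.Flat f₁.hom.hom.hom.left ∧
      CategoryTheory.CategoryStruct.comp g₁ Ψ = CategoryTheory.CategoryStruct.comp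
      (Literature.AlgebraicGeometry.Motives.AbelianVariety.prodLift
      (CategoryTheory.CategoryStruct.comp (Literature.AlgebraicGeometry.Motives.AbelianVariety.snd
      A₁ A₁) (-((p : ℤ) • CategoryTheory.CategoryStruct.id A₁)))
      (Literature.AlgebraicGeometry.Motives.AbelianVariety.fst A₁ A₁)) g₁) ∧
      CategoryTheory.CategoryStruct.comp (CategoryTheory.CategoryStruct.comp e₀.hom
      (Literature.AlgebraicGeometry.Motives.fiberι f s₀)) g = CategoryTheory.CategoryStruct.comp
      Ψ.hom.hom.hom (CategoryTheory.CategoryStruct.comp e₀.hom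
      (Literature.AlgebraicGeometry.Motives.fiberι f s₀)))
    (hV : WeilVariationalHodge) : HodgeWeilLadder := by
  intro p hp hp4 hp7 g hg n hn A φ hA hφ c hrat hH hW
  have hn1 : 1 ≤ n := by have := owf_three_le_k hp7 hg hn; omega
  exact hodgeWeil_of_weilVariationalHodge_of_deligneWeilFamily hF hV p hp hp4 hp7 n hn1 A φ hA hφ c hrat hH hW

/-- **The summit GIVEN the off-sector conjunct**: `DeligneWeilFamily → WeilVariationalHodge →
SummitOffWeilSector → HodgeConjecture` — the whole `ℚ(√-p)` Hodge–Weil sector is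
`hodgeWeil_of_weilVariationalHodge_of_deligneWeilFamily`, and `SummitOffWeilSector`
(stmt-HodgeConjecture-14374, conjecture-grade) is by definition the rest.  The `closes`-shaped standing of the
route over its items 16866, 14497, 14374, with the rung cruxes, `HeckePrymAnchors`, `ProductDescent` and
`WeilDescending` all eliminated. [cite: Deligne1982HodgeCycles, proof of Thm. 4.8] [cite: Grothendieck1966, footnote 13] -/
theorem hodgeConjecture_of_deligneWeilFamily_of_weilVariationalHodge_of_offWeilSector (hF :
      ∀ p : ℕ, p.Prime → p % 4 = 3 → 7 ≤ p → ∀ (k : ℕ), 1 ≤ k → ∀ (X :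
      Literature.AlgebraicGeometry.Motives.AbelianVariety ℂ) (Φ : X ⟶ X), X.dim = 2 * k →
      CategoryTheory.CategoryStruct.comp Φ Φ = -((p : ℤ) • CategoryTheory.CategoryStruct.id X) → ∀ c
      : Literature.AlgebraicGeometry.HodgeTheory.complexBetti X.X (2 * k), c ∈
      Literature.AlgebraicGeometry.HodgeTheory.weilClassesOf X Φ k p → c ≠ 0 →
      Literature.AlgebraicGeometry.HodgeTheory.IsRationalClass c →
      Literature.AlgebraicGeometry.HodgeTheory.IsOfHodgeType (2 * k) X.X (2 * k) k k c → ∃ (𝒳 S :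
      Literature.AlgebraicGeometry.Motives.SchemeOver ℂ) (f : 𝒳 ⟶ S) (g : 𝒳 ⟶ 𝒳) (s₁ s₀ :
      Literature.AlgebraicGeometry.Motives.ComplexPoints S) (e : X.X ≅
      Literature.AlgebraicGeometry.Motives.fiberOver f s₁) (W :
      Literature.AlgebraicGeometry.HodgeTheory.complexBetti 𝒳 (2 * k)),
      Literature.AlgebraicGeometry.Motives.IsSmoothProjectiveFamily f (2 * k) ∧ (∃ (N : ℕ) (ι : 𝒳 ⟶
      CategoryTheory.MonoidalCategoryStruct.tensorObj
      (Literature.AlgebraicGeometry.Motives.projectiveSpace N ℂ) S),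
      AlgebraicGeometry.IsClosedImmersion ι.left ∧ CategoryTheory.CategoryStruct.comp ι
      (CategoryTheory.SemiCartesianMonoidalCategory.snd
      (Literature.AlgebraicGeometry.Motives.projectiveSpace N ℂ) S) = f) ∧ IrreducibleSpace S.left ∧
      AlgebraicGeometry.Smooth S.hom ∧ (∃ (P : Literature.AlgebraicGeometry.Motives.SchemeOver ℂ) (j
      : S ⟶ P), Literature.AlgebraicGeometry.Motives.IsProjectiveOver P ∧
      AlgebraicGeometry.IsOpenImmersion j.left) ∧ CategoryTheory.CategoryStruct.comp g f = f ∧ (∀ s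
      : Literature.AlgebraicGeometry.Motives.ComplexPoints S, ∃ (A' :
      Literature.AlgebraicGeometry.Motives.AbelianVariety ℂ) (φ' : A' ⟶ A') (e' : A'.X ≅
      Literature.AlgebraicGeometry.Motives.fiberOver f s), A'.dim = 2 * k ∧
      CategoryTheory.CategoryStruct.comp φ' φ' = -((p : ℤ) • CategoryTheory.CategoryStruct.id A') ∧
      CategoryTheory.CategoryStruct.comp (CategoryTheory.CategoryStruct.comp e'.hom
      (Literature.AlgebraicGeometry.Motives.fiberι f s)) g = CategoryTheory.CategoryStruct.comp
      φ'.hom.hom.hom (CategoryTheory.CategoryStruct.comp e'.hom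
      (Literature.AlgebraicGeometry.Motives.fiberι f s))) ∧ CategoryTheory.CategoryStruct.comp
      (CategoryTheory.CategoryStruct.comp e.hom (Literature.AlgebraicGeometry.Motives.fiberι f s₁))
      g = CategoryTheory.CategoryStruct.comp Φ.hom.hom.hom (CategoryTheory.CategoryStruct.comp e.hom
      (Literature.AlgebraicGeometry.Motives.fiberι f s₁)) ∧
      Literature.AlgebraicGeometry.HodgeTheory.complexBetti.map
      (Literature.AlgebraicGeometry.Motives.fiberι f s₁) (2 * k) W =
      Literature.AlgebraicGeometry.HodgeTheory.complexBetti.map e.inv (2 * k) c ∧ ∃ (Y :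
      Literature.AlgebraicGeometry.Motives.AbelianVariety ℂ) (Ψ : Y ⟶ Y) (e₀ : Y.X ≅
      Literature.AlgebraicGeometry.Motives.fiberOver f s₀), (∃ (A₁ :
      Literature.AlgebraicGeometry.Motives.AbelianVariety ℂ) (f₁ : Y ⟶ A₁.prod A₁) (g₁ : A₁.prod A₁
      ⟶ Y) (m : ℕ), A₁.dim = k ∧ Y.dim = 2 * k ∧ CategoryTheory.CategoryStruct.comp Ψ Ψ = -((p : ℤ)
      • CategoryTheory.CategoryStruct.id Y) ∧ 0 < m ∧ CategoryTheory.CategoryStruct.comp f₁ g₁ = m •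
      CategoryTheory.CategoryStruct.id Y ∧ AlgebraicGeometry.Flat f₁.hom.hom.hom.left ∧
      CategoryTheory.CategoryStruct.comp g₁ Ψ = CategoryTheory.CategoryStruct.comp
      (Literature.AlgebraicGeometry.Motives.AbelianVariety.prodLift
      (CategoryTheory.CategoryStruct.comp (Literature.AlgebraicGeometry.Motives.AbelianVariety.snd
      A₁ A₁) (-((p : ℤ) • CategoryTheory.CategoryStruct.id A₁)))
      (Literature.AlgebraicGeometry.Motives.AbelianVariety.fst A₁ A₁)) g₁) ∧
      CategoryTheory.CategoryStruct.comp (CategoryTheory.CategoryStruct.comp e₀.hom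
      (Literature.AlgebraicGeometry.Motives.fiberι f s₀)) g = CategoryTheory.CategoryStruct.comp
      Ψ.hom.hom.hom (CategoryTheory.CategoryStruct.comp e₀.hom
      (Literature.AlgebraicGeometry.Motives.fiberι f s₀)))
    (hV : WeilVariationalHodge) (hOff : SummitOffWeilSector) : _root_.HodgeConjecture :=
  hOff (fun p hp hp4 hp7 n hn A φ hA hφ c hrat hH hW =>
    hodgeWeil_of_weilVariationalHodge_of_deligneWeilFamily hF hV p hp hp4 hp7 n hn A φ hA hφ c hrat hH hW)

end Summit.HodgeConjecture.HodgeConjecture.Theorems.HeckePrymWeilLine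

end
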